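import Literature.NumberTheory.LFunctions.Zhang2022.RepairBedClassNumberFormula
import Literature.NumberTheory.QuadraticFields.RealQuadraticFundamentalUnitValues
import Literature.NumberTheory.QuadraticFields.RealQuadraticClassNumberOneSmall
import Literature.NumberTheory.QuadraticFields.RealQuadraticClassNumberOneInert
import Literature.NumberTheory.QuadraticFields.RealQuadraticClassNumber1365
import Literature.NumberTheory.QuadraticFields.RealQuadraticClassNumberOneRepresented
import Literature.NumberTheory.QuadraticFields.RealQuadraticFundamentalUnitCycle
import Literature.NumberTheory.QuadraticFields.RealQuadraticClassNumberOne225077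
import HarnessLib

/-!
# Zhang (2022) rescue bed (D-0124 (3)): the class number formula at the POSITIVE bed moduli —
# `L(1, χ_D) = 2 h_K log ε_D/√D` with the kernel units `ε_D`, closed forms at `D = 5, 8, 12, 13`

Topic `Literature/NumberTheory/LFunctions/Zhang2022` (Landau–Siegel audit tree; verdict-neutral), cell landau-siegel,
LS RESCUE PROTOCOL (human ruling D-0124) part (3) «GENUINE BED», typer seat ls-rescue-typ-1. Companion of
`RepairBedClassNumberFormula.lean` (negative moduli: `LOne D = π·h(D)/√|D|`; positive moduli:
`LOne_eq_log_fundUnit_of_discr_pos`: `LOne D = 2 h_K log (QuadIrr.fundUnit D)/√D`) and of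
`QuadraticFields/RealQuadraticFundamentalUnitValues.lean` (kernel values of `QuadIrr.fundUnit D` at the bed's positive
moduli; `h_K = 1` for `d_K < 16`). Y. Zhang, *Discrete mean estimates and the Landau–Siegel zero*, arXiv:2211.02515v1
(2022) [Zhang2022LandauSiegel] — an unrefereed manuscript under adjudication. **Nothing in this file asserts or denies
any of its claims; nothing here is a claim about Landau–Siegel zeros. The programme SEARCHES and TYPES; no claim about
Landau–Siegel zeros, Theorems 1–2 of arXiv:2211.02515 or a repaired Margin232 until a kernel theorem says so.**
Everything below is PROVED (theorems only).

Bed-1 spec `bed1-KG1-v0.1` (sha16 `dea02fd073922aeb`), block G101, positive moduli of lists `L1a ∪ L1b`: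
`5, 8, 12, 13, 17, 21, 24, 28, 29, 1365`; columns G01 (`h(D)` and the regulator `log ε_D`) and G02(i) (`L(1, χ_D)`
from G01 by the class number formula).

## What is here (all PROVED)

* FIELD-FREE closed forms where the tree also knows `h_K = 1` (Minkowski, `d_K < 16`):
  **`LOne_pos5 : L(1, χ₅) = 2 log((1+√5)/2)/√5`**, **`LOne_pos8 : L(1, χ₈) = 2 log(1+√2)/√8`**,
  **`LOne_pos12 : L(1, χ₁₂) = 2 log(2+√3)/√12`**, **`LOne_pos13 : L(1, χ₁₃) = 2 log((3+√13)/2)/√13`**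
  (written with the units as `(t + u√D)/2`).
* With the field's class number as the one remaining integer (`h_K = NumberField.classNumber K` of the quadratic field
  `K` with `d_K = D`; no kernel value at these `D`): `LOne_pos17_of_discr_eq` (`ε = 4 + √17`), `LOne_pos21_of_discr_eq`
  (`(5+√21)/2`), `LOne_pos24_of_discr_eq` (`5 + 2√6`), `LOne_pos28_of_discr_eq` (`8 + 3√7`), `LOne_pos29_of_discr_eq`
  (`(5+√29)/2`), `LOne_pos1365_of_discr_eq` (`(37+√1365)/2`): `LOne D = 2 h_K log ε_D/√D`.

So at every positive bed-1 modulus the G02(i) value is a kernel expression in at most ONE engine-supplied integer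
(`h_K`), and at `D ∈ {5, 8, 12, 13}` a kernel constant.
* Rev 2 (append, §3): with `QuadraticFields/RealQuadraticClassNumberOneSmall.lean` (`h_K = 1` for every real quadratic
  field with `d_K < 36`: Minkowski `< 3` and the prime `2`) the class number disappears at `D = 17, 21, 24, 28, 29` too:
  **`LOne_pos17 = 2 log(4+√17)/√17`**, **`LOne_pos21 = 2 log((5+√21)/2)/√21`**, **`LOne_pos24 = 2 log(5+2√6)/√24`**,
  **`LOne_pos28 = 2 log(8+3√7)/√28`**, **`LOne_pos29 = 2 log((5+√29)/2)/√29`** — G02(i) is a KERNEL CONSTANT at nine of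
  the ten positive bed-1 moduli; only `D = 1365` (`h_K = 4` in the tables, `M_K ≈ 18.5`) keeps the field's `h_K`.
* Rev 3 (append, §4): the POSITIVE RUNGS of the all-inert ladder (rule L1y; kernel certificates
  `isLeastAllInert_five_pos53 / _pos173 / _thirteen_pos293 / _pos437` of `RepairBedLadderCertificates.lean`). With
  `QuadraticFields/RealQuadraticClassNumberOneInert.lean` (`h_K = 1` when every prime below `M_K = √d_K/2` is inert) the
  bridge `classNumber_eq_one_of_allInertUpTo` (`AllInertUpTo y d_K ∧ d_K < 4(y+1)² ⇒ h_K = 1`) and the closed forms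
  **`LOne_pos53 = 2 log((7+√53)/2)/√53`**, **`LOne_pos173 = 2 log((13+√173)/2)/√173`**,
  **`LOne_pos293 = 2 log((17+√293)/2)/√293`**, **`LOne_pos437 = 2 log((21+√437)/2)/√437`** — with the negative rungs
  (`LOne_eq_pi_div_sqrt_of_mem`: −19, −43, −67, −163; `LOne_neg77683`) the G02(i) column is a KERNEL CONSTANT at every
  kernel-certified ladder rung with `|D| < 500` (deeper positive rungs `9173, 24653, …` have `M_K` beyond the inert range).
* Rev 4 (append, §5): the LAST positive modulus. `QuadraticFields/RealQuadraticClassNumber1365.lean` proves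
  `h(ℚ(√1365)) = 4` in the kernel (`Quadratic.classNumber_eq_four_of_discr_eq_1365`: Minkowski `M_K < 19`; `2, 17` inert,
  `3, 5, 7, 13` ramified, `11` split; relations `(17+ω) = 𝔭₅𝔭₇`, `(19+ω) = 𝔭₃𝔭₁₃`, `(22+ω) = 𝔭₃𝔭₅𝔭₁₁`; `𝔭₃, 𝔭₅, 𝔭₃𝔭₅`
  non-principal by congruences), hence **`LOne_pos1365 = 8 log((37+√1365)/2)/√1365`** — G02(i) is a KERNEL CONSTANT at
  ALL ten positive bed-1 L1 moduli.
* Rev 5 (append, §6): the next ladder rung `D_19^+ = D_23^+ = 9173` (`RepairBedLadderCertificates.isLeastAllInert_pos9173`).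
  `QuadraticFields/RealQuadraticClassNumberOneRepresented.lean` gives `h(ℚ(√9173)) = 1` (`M_K < 48`; the primes `≤ 23`
  and `41` inert, the split primes `29, 31, 37, 43, 47` norms of explicit elements) and the unit
  `ε₉₁₇₃ = (260989 + 2725√9173)/2` by a small finite check, hence
  **`LOne_pos9173 = 2 log((260989 + 2725√9173)/2)/√9173`**.
* Rev 6 (append, §7): the POSITIVE `L2` CHAMPION and the deep positive rungs. `QuadraticFields/RealQuadraticFundamentalUnitCycle.lean`
  certifies `ε_D` through its definition (a computable run of the principal cycle: `cycleCert`, `fundUnit_eq_of_cycleCert`),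
  which gives the units at `D = 225077` (period `53`, `log ε = 57.17005…`), `214037` (period `32`), `24653`, `74093`, `170957`;
  `QuadraticFields/RealQuadraticClassNumberOne225077.lean` gives `h(ℚ(√225077)) = 1` (`M_K < 238`; 31 inert primes, 20 norm
  witnesses). Hence **`LOne_pos225077 = 2 log((6739660009445796881424161 + 14206020256690055107145√225077)/2)/√225077`**
  (`= 0.24100…`) — the least `L(1, χ_D)` over the fundamental `200 < D ≤ 3·10⁵` of the bed's champion table (rule `L2`,
  positive side) is a KERNEL CONSTANT, as is the negative side's `LOne_neg222643` (companion file, rev 3) — and the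
  `h_K`-symbolic forms `LOne_pos214037_of_discr_eq` (`214037 = 193·1109`, `h = 2` in the tables), `LOne_pos24653_of_discr_eq`
  (`89·277`, `h = 4`), `LOne_pos74093_of_discr_eq` (`h = 5`), `LOne_pos170957_of_discr_eq` (`h = 3`): at every positive rung of
  the all-inert ladder with `D ≤ 3·10⁵` the G02(i) value is now `2 h_K log ε_D/√D` with a KERNEL unit (those four class
  numbers are not in the tree).

## References

* [DavenportMNT1980] H. Davenport, *Multiplicative Number Theory*, 2nd ed. (1980), Ch. 6 (`h(d) log ε = d^{1/2} L(1, χ_d)`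
  for `d > 0`, in the normalisation `ε = (t + u√d)/2`).
* [JacobsonWilliams2008] M. J. Jacobson, H. C. Williams, *Solving the Pell Equation* (2008), §3.3 Table 3.1, §5.3.
* [NeukirchANT1999] J. Neukirch, *Algebraic Number Theory* (1999), Ch. VII §5 (5.11).
-/

noncomputable section

open NumberField NumberField.Units

namespace Literature.NumberTheory.LFunctions.Zhang2022.Repair.Bed

open Literature.Barriers.RiemannHypothesis (IsFundamentalDiscriminant)
open Literature.NumberTheory.QuadraticFields
open Literature.NumberTheory.QuadraticFields.Quadratic

/-! ## §1 Closed forms at `D = 5, 8, 12, 13` (`h_K = 1` by Minkowski) -/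

/-- **`L(1, χ₅) = 2 log((1 + √5)/2)/√5`** (`= 0.43041…`; `h = 1`, `ε₅ = (1+√5)/2`). The quadratic field of
discriminant `5` exists (`Quadratic.exists_numberField_discr_eq`), has `h_K = 1`
(`Quadratic.classNumber_eq_one_of_discr_pos_lt_sixteen`) and `R_K = log ε₅` (`Quadratic.regulator_of_discr_eq_five`).
[cite: DavenportMNT1980, Ch. 6] -/
theorem LOne_pos5 : LOne 5 = 2 * Real.log ((1 + 1 * Real.sqrt 5) / 2) / Real.sqrt 5 := by
  obtain ⟨K, _, _, h2, hdK⟩ :=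
    exists_numberField_discr_eq (isFundamentalDiscriminant_of_mem_bed1Moduli 5 (by decide))
  have h := LOne_eq_of_discr_pos h2 hdK (by norm_num)
  rw [mul_assoc, classNumber_mul_regulator_of_discr_eq_five h2 hdK] at h
  push_cast at h
  exact h

/-- **`L(1, χ₈) = 2 log(1 + √2)/√8`** (`= log(1+√2)/√2 = 0.62322…`; `h = 1`, `ε₈ = 1 + √2 = (2+√8)/2`).
[cite: DavenportMNT1980, Ch. 6] -/
theorem LOne_pos8 : LOne 8 = 2 * Real.log ((2 + 1 * Real.sqrt 8) / 2) / Real.sqrt 8 := by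
  obtain ⟨K, _, _, h2, hdK⟩ :=
    exists_numberField_discr_eq (isFundamentalDiscriminant_of_mem_bed1Moduli 8 (by decide))
  have h := LOne_eq_of_discr_pos h2 hdK (by norm_num)
  rw [mul_assoc, classNumber_mul_regulator_of_discr_eq_eight h2 hdK] at h
  push_cast at h
  exact h

/-- **`L(1, χ₁₂) = 2 log(2 + √3)/√12`** (`= log(2+√3)/√3 = 0.76035…`; `h = 1`, `ε₁₂ = 2 + √3 = (4+√12)/2`).
[cite: DavenportMNT1980, Ch. 6] -/
theorem LOne_pos12 : LOne 12 = 2 * Real.log ((4 + 1 * Real.sqrt 12) / 2) / Real.sqrt 12 := by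
  obtain ⟨K, _, _, h2, hdK⟩ :=
    exists_numberField_discr_eq (isFundamentalDiscriminant_of_mem_bed1Moduli 12 (by decide))
  have h := LOne_eq_of_discr_pos h2 hdK (by norm_num)
  rw [mul_assoc, classNumber_mul_regulator_of_discr_eq_twelve h2 hdK] at h
  push_cast at h
  exact h

/-- **`L(1, χ₁₃) = 2 log((3 + √13)/2)/√13`** (`= 0.66274…`; `h = 1`, `ε₁₃ = (3+√13)/2`). [cite: DavenportMNT1980, Ch. 6] -/
theorem LOne_pos13 : LOne 13 = 2 * Real.log ((3 + 1 * Real.sqrt 13) / 2) / Real.sqrt 13 := by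
  obtain ⟨K, _, _, h2, hdK⟩ :=
    exists_numberField_discr_eq (isFundamentalDiscriminant_of_mem_bed1Moduli 13 (by decide))
  have h := LOne_eq_of_discr_pos h2 hdK (by norm_num)
  rw [mul_assoc, classNumber_mul_regulator_of_discr_eq_thirteen h2 hdK] at h
  push_cast at h
  exact h

/-! ## §2 The other positive moduli: `LOne D = 2 h_K log ε_D/√D` with the kernel unit and the field's `h_K` -/

section WithField

variable {K : Type*} [Field K] [NumberField K]

/-- `D = 17`: `L(1, χ₁₇) = 2 h_K log(4 + √17)/√17` for the quadratic field `K` with `d_K = 17` (`ε₁₇ = (8+2√17)/2`).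
[cite: DavenportMNT1980, Ch. 6] -/
theorem LOne_pos17_of_discr_eq (h2 : Module.finrank ℚ K = 2) (hd : NumberField.discr K = 17) :
    LOne 17 = 2 * NumberField.classNumber K * Real.log ((8 + 2 * Real.sqrt 17) / 2) / Real.sqrt 17 := by
  have h := LOne_eq_of_discr_pos h2 hd (by norm_num)
  rw [regulator_of_discr_eq_seventeen h2 hd] at h
  push_cast at h
  exact h

/-- `D = 21`: `L(1, χ₂₁) = 2 h_K log((5 + √21)/2)/√21` for the quadratic field with `d_K = 21`. [cite: DavenportMNT1980, Ch. 6] -/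
theorem LOne_pos21_of_discr_eq (h2 : Module.finrank ℚ K = 2) (hd : NumberField.discr K = 21) :
    LOne 21 = 2 * NumberField.classNumber K * Real.log ((5 + 1 * Real.sqrt 21) / 2) / Real.sqrt 21 := by
  have h := LOne_eq_of_discr_pos h2 hd (by norm_num)
  rw [regulator_of_discr_eq_twentyOne h2 hd] at h
  push_cast at h
  exact h

/-- `D = 24`: `L(1, χ₂₄) = 2 h_K log(5 + 2√6)/√24` for the quadratic field with `d_K = 24` (`ε₂₄ = (10+2√24)/2`).
[cite: DavenportMNT1980, Ch. 6] -/
theorem LOne_pos24_of_discr_eq (h2 : Module.finrank ℚ K = 2) (hd : NumberField.discr K = 24) :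
    LOne 24 = 2 * NumberField.classNumber K * Real.log ((10 + 2 * Real.sqrt 24) / 2) / Real.sqrt 24 := by
  have h := LOne_eq_of_discr_pos h2 hd (by norm_num)
  rw [regulator_of_discr_eq_twentyFour h2 hd] at h
  push_cast at h
  exact h

/-- `D = 28`: `L(1, χ₂₈) = 2 h_K log(8 + 3√7)/√28` for the quadratic field with `d_K = 28` (`ε₂₈ = (16+3√28)/2`).
[cite: DavenportMNT1980, Ch. 6] -/
theorem LOne_pos28_of_discr_eq (h2 : Module.finrank ℚ K = 2) (hd : NumberField.discr K = 28) :
    LOne 28 = 2 * NumberField.classNumber K * Real.log ((16 + 3 * Real.sqrt 28) / 2) / Real.sqrt 28 := by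
  have h := LOne_eq_of_discr_pos h2 hd (by norm_num)
  rw [regulator_of_discr_eq_twentyEight h2 hd] at h
  push_cast at h
  exact h

/-- `D = 29`: `L(1, χ₂₉) = 2 h_K log((5 + √29)/2)/√29` for the quadratic field with `d_K = 29`. [cite: DavenportMNT1980, Ch. 6] -/
theorem LOne_pos29_of_discr_eq (h2 : Module.finrank ℚ K = 2) (hd : NumberField.discr K = 29) :
    LOne 29 = 2 * NumberField.classNumber K * Real.log ((5 + 1 * Real.sqrt 29) / 2) / Real.sqrt 29 := by
  have h := LOne_eq_of_discr_pos h2 hd (by norm_num)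
  rw [regulator_of_discr_eq_twentyNine h2 hd] at h
  push_cast at h
  exact h

/-- `D = 1365` (`= 3·5·7·13`): `L(1, χ₁₃₆₅) = 2 h_K log((37 + √1365)/2)/√1365` for the quadratic field with
`d_K = 1365`. [cite: DavenportMNT1980, Ch. 6] -/
theorem LOne_pos1365_of_discr_eq (h2 : Module.finrank ℚ K = 2) (hd : NumberField.discr K = 1365) :
    LOne 1365 =
      2 * NumberField.classNumber K * Real.log ((37 + 1 * Real.sqrt 1365) / 2) / Real.sqrt 1365 := by
  have h := LOne_eq_of_discr_pos h2 hd (by norm_num)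
  rw [regulator_of_discr_eq_1365 h2 hd] at h
  push_cast at h
  exact h

end WithField

/-! ## §3 Rev 2 (append): FIELD-FREE closed forms at `D = 17, 21, 24, 28, 29` (`h_K = 1` by
`Quadratic.classNumber_eq_one_of_discr_eq_seventeen … _twentyNine` of `QuadraticFields/RealQuadraticClassNumberOneSmall.lean`) -/

/-- **`L(1, χ₁₇) = 2 log(4 + √17)/√17`** (`= 1.01608…`; `h = 1`, `ε₁₇ = 4 + √17 = (8+2√17)/2`). The quadratic field of
discriminant `17` exists, has `h_K = 1` (`Quadratic.classNumber_eq_one_of_discr_eq_seventeen`: `2` splits into principal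
primes) and `R_K = log ε₁₇`. [cite: DavenportMNT1980, Ch. 6] -/
theorem LOne_pos17 : LOne 17 = 2 * Real.log ((8 + 2 * Real.sqrt 17) / 2) / Real.sqrt 17 := by
  obtain ⟨K, _, _, h2, hdK⟩ :=
    exists_numberField_discr_eq (isFundamentalDiscriminant_of_mem_bed1Moduli 17 (by decide))
  rw [LOne_pos17_of_discr_eq h2 hdK, classNumber_eq_one_of_discr_eq_seventeen h2 hdK, Nat.cast_one, mul_one]

/-- **`L(1, χ₂₁) = 2 log((5 + √21)/2)/√21`** (`= 0.68380…`; `h = 1` as `21 ≡ 5 (mod 8)` makes `2` inert,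
`Quadratic.classNumber_eq_one_of_discr_eq_twentyOne`; `ε₂₁ = (5+√21)/2`). [cite: DavenportMNT1980, Ch. 6] -/
theorem LOne_pos21 : LOne 21 = 2 * Real.log ((5 + 1 * Real.sqrt 21) / 2) / Real.sqrt 21 := by
  obtain ⟨K, _, _, h2, hdK⟩ :=
    exists_numberField_discr_eq (isFundamentalDiscriminant_of_mem_bed1Moduli 21 (by decide))
  rw [LOne_pos21_of_discr_eq h2 hdK, classNumber_eq_one_of_discr_eq_twentyOne h2 hdK, Nat.cast_one, mul_one]

/-- **`L(1, χ₂₄) = 2 log(5 + 2√6)/√24`** (`= 0.93588…`; `h = 1`, `Quadratic.classNumber_eq_one_of_discr_eq_twentyFour`: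
`N(2 + √6) = −2`; `ε₂₄ = 5 + 2√6 = (10+2√24)/2`). [cite: DavenportMNT1980, Ch. 6] -/
theorem LOne_pos24 : LOne 24 = 2 * Real.log ((10 + 2 * Real.sqrt 24) / 2) / Real.sqrt 24 := by
  obtain ⟨K, _, _, h2, hdK⟩ :=
    exists_numberField_discr_eq (isFundamentalDiscriminant_of_mem_bed1Moduli 24 (by decide))
  rw [LOne_pos24_of_discr_eq h2 hdK, classNumber_eq_one_of_discr_eq_twentyFour h2 hdK, Nat.cast_one, mul_one]

/-- **`L(1, χ₂₈) = 2 log(8 + 3√7)/√28`** (`= 1.04645…`; `h = 1`, `Quadratic.classNumber_eq_one_of_discr_eq_twentyEight`: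
`N(3 + √7) = 2`; `ε₂₈ = 8 + 3√7 = (16+3√28)/2`). [cite: DavenportMNT1980, Ch. 6] -/
theorem LOne_pos28 : LOne 28 = 2 * Real.log ((16 + 3 * Real.sqrt 28) / 2) / Real.sqrt 28 := by
  obtain ⟨K, _, _, h2, hdK⟩ :=
    exists_numberField_discr_eq (isFundamentalDiscriminant_of_mem_bed1Moduli 28 (by decide))
  rw [LOne_pos28_of_discr_eq h2 hdK, classNumber_eq_one_of_discr_eq_twentyEight h2 hdK, Nat.cast_one, mul_one]

/-- **`L(1, χ₂₉) = 2 log((5 + √29)/2)/√29`** (`= 0.61176…`; `h = 1` as `29 ≡ 5 (mod 8)` makes `2` inert,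
`Quadratic.classNumber_eq_one_of_discr_eq_twentyNine`; `ε₂₉ = (5+√29)/2`). [cite: DavenportMNT1980, Ch. 6] -/
theorem LOne_pos29 : LOne 29 = 2 * Real.log ((5 + 1 * Real.sqrt 29) / 2) / Real.sqrt 29 := by
  obtain ⟨K, _, _, h2, hdK⟩ :=
    exists_numberField_discr_eq (isFundamentalDiscriminant_of_mem_bed1Moduli 29 (by decide))
  rw [LOne_pos29_of_discr_eq h2 hdK, classNumber_eq_one_of_discr_eq_twentyNine h2 hdK, Nat.cast_one, mul_one]

/-! ## §4 Rev 3 (append): the positive ALL-INERT LADDER rungs `53, 173, 293, 437` (rule L1y) — `h_K = 1` because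
every prime below `M_K = √D/2` is inert (`Quadratic.classNumber_eq_one_of_inert`,
`QuadraticFields/RealQuadraticClassNumberOneInert.lean`) -/

section Ladder

variable {K : Type*} [Field K] [NumberField K]

/-- **Bridge from the bed's ladder predicate**: if `AllInertUpTo y d_K` (`RepairBedModuli`: `d_K ≡ 5 (mod 8)` and
`(d_K/p) = −1` for every odd prime `p ≤ y`) with `2 ≤ y` and `0 < d_K < 4(y+1)²` (Minkowski `M_K = √d_K/2 < y + 1`),
then `h_K = 1`. [cite: LehmerLehmerShanks1970, §1] -/
theorem classNumber_eq_one_of_allInertUpTo (h2 : Module.finrank ℚ K = 2) {y : ℕ} (hy : 2 ≤ y)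
    (hA : AllInertUpTo y (NumberField.discr K)) (hd : 0 < NumberField.discr K)
    (hlt : NumberField.discr K < 4 * ((y : ℤ) + 1) ^ 2) : NumberField.classNumber K = 1 :=
  classNumber_eq_one_of_inert h2 hd hlt (hA.1 hy) fun p hp hp2 hpy => hA.2 p hp hp2 hpy

end Ladder

/-- **`L(1, χ₅₃) = 2 log((7 + √53)/2)/√53`** (`= 0.54002…`; rung `D_5^+ = 53`, `h = 1` since `2, 3` are inert below
`M_K = 3.64`; `ε₅₃ = (7+√53)/2`). [cite: DavenportMNT1980, Ch. 6] -/
theorem LOne_pos53 : LOne 53 = 2 * Real.log ((7 + 1 * Real.sqrt 53) / 2) / Real.sqrt 53 := by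
  obtain ⟨K, _, _, h2, hdK⟩ := exists_numberField_discr_eq isFundamentalDiscriminant_pos_rungs.1
  have h := LOne_eq_of_discr_pos h2 hdK (by norm_num)
  rw [mul_assoc, classNumber_mul_regulator_of_discr_eq_53 h2 hdK] at h
  push_cast at h
  exact h

/-- **`L(1, χ₁₇₃) = 2 log((13 + √173)/2)/√173`** (`= 0.39091…`; rung `D_7^+ = D_11^+ = 173`, `h = 1` since `2, 3, 5`
are inert below `M_K = 6.58`; `ε₁₇₃ = (13+√173)/2`). [cite: DavenportMNT1980, Ch. 6] -/
theorem LOne_pos173 : LOne 173 = 2 * Real.log ((13 + 1 * Real.sqrt 173) / 2) / Real.sqrt 173 := by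
  obtain ⟨K, _, _, h2, hdK⟩ := exists_numberField_discr_eq isFundamentalDiscriminant_pos_rungs.2.1
  have h := LOne_eq_of_discr_pos h2 hdK (by norm_num)
  rw [mul_assoc, classNumber_mul_regulator_of_discr_eq_173 h2 hdK] at h
  push_cast at h
  exact h

/-- **`L(1, χ₂₉₃) = 2 log((17 + √293)/2)/√293`** (`= 0.33143…`; rung `D_13^+ = 293`, `h = 1` since `2, 3, 5, 7` are
inert below `M_K = 8.56`; `ε₂₉₃ = (17+√293)/2`). [cite: DavenportMNT1980, Ch. 6] -/
theorem LOne_pos293 : LOne 293 = 2 * Real.log ((17 + 1 * Real.sqrt 293) / 2) / Real.sqrt 293 := by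
  obtain ⟨K, _, _, h2, hdK⟩ := exists_numberField_discr_eq isFundamentalDiscriminant_pos_rungs.2.2
  have h := LOne_eq_of_discr_pos h2 hdK (by norm_num)
  rw [mul_assoc, classNumber_mul_regulator_of_discr_eq_293 h2 hdK] at h
  push_cast at h
  exact h

/-- **`L(1, χ₄₃₇) = 2 log((21 + √437)/2)/√437`** (`= 0.29106…`; rung `D_17^+ = 437 = 19·23`, `h = 1` since
`2, 3, 5, 7` are inert below `M_K = 10.45`; `ε₄₃₇ = (21+√437)/2`). [cite: DavenportMNT1980, Ch. 6] -/
theorem LOne_pos437 : LOne 437 = 2 * Real.log ((21 + 1 * Real.sqrt 437) / 2) / Real.sqrt 437 := by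
  obtain ⟨K, _, _, h2, hdK⟩ := exists_numberField_discr_eq isFundamentalDiscriminant_rungs_two.1
  have h := LOne_eq_of_discr_pos h2 hdK (by norm_num)
  rw [mul_assoc, classNumber_mul_regulator_of_discr_eq_437 h2 hdK] at h
  push_cast at h
  exact h

/-! ## §5 Rev 4 (append): `D = 1365` — `h_K = 4` in the kernel (`Quadratic.classNumber_eq_four_of_discr_eq_1365`,
`QuadraticFields/RealQuadraticClassNumber1365.lean`) -/

/-- **`L(1, χ₁₃₆₅) = 8 log((37 + √1365)/2)/√1365`** (`= 0.78172…`; `h = 4` — `Quadratic.classNumber_eq_four_of_discr_eq_1365`: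
the classes `1, [𝔭₃], [𝔭₅], [𝔭₃𝔭₅]` of the quadratic field of discriminant `1365 = 3·5·7·13`; `ε₁₃₆₅ = (37+√1365)/2`).
With this the G02(i) column is a kernel constant at every positive bed-1 `L1` modulus. [cite: DavenportMNT1980, Ch. 6] -/
theorem LOne_pos1365 : LOne 1365 = 8 * Real.log ((37 + 1 * Real.sqrt 1365) / 2) / Real.sqrt 1365 := by
  obtain ⟨K, _, _, h2, hdK⟩ :=
    exists_numberField_discr_eq (isFundamentalDiscriminant_of_mem_bed1Moduli 1365 (by decide))
  rw [LOne_pos1365_of_discr_eq h2 hdK, classNumber_eq_four_of_discr_eq_1365 h2 hdK]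
  norm_num

/-! ## §6 Rev 5 (append): the ladder rung `D = 9173` (`y = 19, 23`) — `h_K = 1` and `ε₉₁₇₃` in the kernel
(`Quadratic.classNumber_eq_one_of_discr_eq_9173`, `QuadIrr.fundUnit_9173`,
`QuadraticFields/RealQuadraticClassNumberOneRepresented.lean`) -/

/-- **`L(1, χ₉₁₇₃) = 2 log((260989 + 2725√9173)/2)/√9173`** (`= 0.26044…`; rung `D_19^+ = D_23^+ = 9173`, `h = 1`:
`M_K = 47.89`, the primes `≤ 23` and `41` inert, `29, 31, 37, 43, 47` norms; `ε₉₁₇₃ = (260989 + 2725√9173)/2`,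
`260989² − 9173·2725² = −4`). [cite: DavenportMNT1980, Ch. 6] -/
theorem LOne_pos9173 : LOne 9173 = 2 * Real.log ((260989 + 2725 * Real.sqrt 9173) / 2) / Real.sqrt 9173 := by
  obtain ⟨K, _, _, h2, hdK⟩ := exists_numberField_discr_eq isFundamentalDiscriminant_rungs_two.2.1
  have h := LOne_eq_of_discr_pos h2 hdK (by norm_num)
  rw [mul_assoc, classNumber_mul_regulator_of_discr_eq_9173 h2 hdK] at h
  push_cast at h
  exact h

/-! ## §7 Rev 6 (append): the positive `L2` champion `D = 225077` and the deep positive rungs `24653, 74093, 170957,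
214037` — kernel units by the principal-cycle certificate (`QuadIrr.fundUnit_225077`, `_214037`, `_24653`, `_74093`,
`_170957` of `QuadraticFields/RealQuadraticFundamentalUnitCycle.lean`; «period» below = the length of the principal
cycle of `ω = (1 + √D)/2`, not the period of `√D`) and `h(ℚ(√225077)) = 1` (`Quadratic.classNumber_eq_one_of_discr_eq_225077`) -/

/-- `225077` (prime, `≡ 1 (mod 4)`) is a fundamental discriminant. [cite: MontgomeryVaughan2007, §9.3] -/
theorem isFundamentalDiscriminant_pos225077 : IsFundamentalDiscriminant 225077 :=
  Or.inl ⟨by decide, (Int.prime_iff_natAbs_prime.mpr (by norm_num)).squarefree, by decide⟩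

/-- **`L(1, χ₂₂₅₀₇₇) = 2 log((6739660009445796881424161 + 14206020256690055107145√225077)/2)/√225077`** (`= 0.24100…`;
`225077` prime, `h = 1`: `M_K = 237.21`, the primes `≤ 41` and 18 further primes `≤ 233` inert, 20 split primes norms;
`ε₂₂₅₀₇₇` of norm `−1`, principal cycle of period `53`, `R_K = 57.17005…`). The least `L(1, χ_D)` among the fundamental
discriminants `200 < D ≤ 3·10⁵` in the bed's tables — now a kernel constant. [cite: DavenportMNT1980, Ch. 6] -/
theorem LOne_pos225077 : LOne 225077 =
    2 * Real.log ((6739660009445796881424161 + 14206020256690055107145 * Real.sqrt 225077) / 2) / Real.sqrt 225077 := by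
  obtain ⟨K, _, _, h2, hdK⟩ := exists_numberField_discr_eq isFundamentalDiscriminant_pos225077
  have h := LOne_eq_of_discr_pos h2 hdK (by norm_num)
  rw [classNumber_eq_one_of_discr_eq_225077 h2 hdK, regulator_of_discr_eq_225077 h2 hdK, Nat.cast_one, mul_one] at h
  push_cast at h
  exact h

section DeepRungs

variable {K : Type*} [Field K] [NumberField K]

/-- `D = 214037 = 193·1109` (rung `D_47^+ = D_53^+ = D_59^+`): `L(1, χ_D) = 2 h_K log((3753351696386 + 8112875904√214037)/2)/√214037`
for the quadratic field `K` with `d_K = 214037` (`ε` of norm `+1`, period `32`, `R_K = 28.95367…`; `h_K = 2` in the tables, not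
in the tree). [cite: DavenportMNT1980, Ch. 6] -/
theorem LOne_pos214037_of_discr_eq (h2 : Module.finrank ℚ K = 2) (hd : NumberField.discr K = 214037) :
    LOne 214037 =
      2 * NumberField.classNumber K * Real.log ((3753351696386 + 8112875904 * Real.sqrt 214037) / 2) / Real.sqrt 214037 := by
  have h := LOne_eq_of_discr_pos h2 hd (by norm_num)
  rw [regulator_of_discr_eq_214037 h2 hd] at h
  push_cast at h
  exact h

/-- `D = 24653 = 89·277` (rung `D_29^+`): `L(1, χ_D) = 2 h_K log((157 + √24653)/2)/√24653` (`ε` of norm `−1`, period `1`,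
`R_K = 5.05628…`; `h_K = 4` in the tables). [cite: DavenportMNT1980, Ch. 6] -/
theorem LOne_pos24653_of_discr_eq (h2 : Module.finrank ℚ K = 2) (hd : NumberField.discr K = 24653) :
    LOne 24653 = 2 * NumberField.classNumber K * Real.log ((157 + 1 * Real.sqrt 24653) / 2) / Real.sqrt 24653 := by
  have h := LOne_eq_of_discr_pos h2 hd (by norm_num)
  rw [regulator_of_discr_eq_24653 h2 hd] at h
  push_cast at h
  exact h

/-- `D = 74093` (prime; rung `D_31^+ = D_37^+ = D_41^+`): `L(1, χ_D) = 2 h_K log((1361 + 5√74093)/2)/√74093` (`ε` of norm `−1`,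
period `5`, `R_K = 7.21597…`; `h_K = 5` in the tables). [cite: DavenportMNT1980, Ch. 6] -/
theorem LOne_pos74093_of_discr_eq (h2 : Module.finrank ℚ K = 2) (hd : NumberField.discr K = 74093) :
    LOne 74093 = 2 * NumberField.classNumber K * Real.log ((1361 + 5 * Real.sqrt 74093) / 2) / Real.sqrt 74093 := by
  have h := LOne_eq_of_discr_pos h2 hd (by norm_num)
  rw [regulator_of_discr_eq_74093 h2 hd] at h
  push_cast at h
  exact h

/-- `D = 170957` (prime; rung `D_43^+`): `L(1, χ_D) = 2 h_K log((22729657 + 54973√170957)/2)/√170957` (`ε` of norm `−1`,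
period `11`, `R_K = 16.93918…`; `h_K = 3` in the tables). [cite: DavenportMNT1980, Ch. 6] -/
theorem LOne_pos170957_of_discr_eq (h2 : Module.finrank ℚ K = 2) (hd : NumberField.discr K = 170957) :
    LOne 170957 =
      2 * NumberField.classNumber K * Real.log ((22729657 + 54973 * Real.sqrt 170957) / 2) / Real.sqrt 170957 := by
  have h := LOne_eq_of_discr_pos h2 hd (by norm_num)
  rw [regulator_of_discr_eq_170957 h2 hd] at h
  push_cast at h
  exact h

end DeepRungs

end Literature.NumberTheory.LFunctions.Zhang2022.Repair.Bed

end
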